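import Literature.NumberTheory.LFunctions.WeilExplicitContinuous
import Literature.NumberTheory.LFunctions.WeilMellinInversion
import Literature.NumberTheory.LFunctions.WeilWindowSuzukiContinuityProofs
import Summits.RiemannHypothesis.RiemannHypothesis.Theorems.PfPersistenceGalerkinFormTests
import HarnessLib

/-!
# Odd parts and mollification commute; the transform of an odd part (PR/FIN bookkeeping for `φ_k = g⁻ ⋆ moll_k`)

WEIL column (LADDER-RH, W-P(P2); tier-1 `ThetaCertificateSound`, items PR/FIN/W3 of THETA-ASSIGN v1.0 §3). For a continuous
compactly supported `f` and the tree mollifier `moll k` (even: `PfPersistence.moll_neg`):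
* `weilConv_comp_neg_moll : (f(−·) ⋆ moll_k)(x) = (f ⋆ moll_k)(−x)`;
* `weilConv_oddPart_moll : (f − f(−·)) ⋆ moll_k = F − F(−·)`, `F = f ⋆ moll_k` — the witness `φ_k = g⁻ ⋆ moll_k` IS the odd part
  of `g ⋆ moll_k`, so the (P_R) split `g = G_R − T_R` passes through mollification term by term;
* `weilMellin_oddPart : (F − F(−·))^(s) = F̂(s) − F̂(1−s)` for `F` continuous compactly supported.
RH-free; nothing here bears on the truth of RH.
-/

set_option linter.dupNamespace false

noncomputable section

open MeasureTheory Set Complex Filter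
open Literature.NumberTheory.LFunctions Literature.NumberTheory.LFunctions.WeilContinuous

namespace Summit.RiemannHypothesis.RiemannHypothesis.Theorems.WeilColumn.ThetaMellin

/-- The mollification integrand `u ↦ f(u)·moll_k(x − u)` is integrable for continuous `f` (the mollifier is continuous with
compact support). [folklore] -/
theorem integrable_mul_moll_comp_sub {f : ℝ → ℂ} (hf : Continuous f) (k : ℕ) (x : ℝ) :
    Integrable fun u : ℝ => f u * moll k (x - u) := by
  have hm : Continuous fun u : ℝ => moll k (x - u) := (continuous_moll k).comp (continuous_const.sub continuous_id)
  have hms : HasCompactSupport fun u : ℝ => moll k (x - u) := by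
    have h := (hasCompactSupport_moll k).comp_homeomorph ((Homeomorph.neg ℝ).trans (Homeomorph.addLeft x))
    have e : (moll k ∘ ⇑((Homeomorph.neg ℝ).trans (Homeomorph.addLeft x))) = fun u : ℝ => moll k (x - u) := by
      funext u; simp [sub_eq_add_neg]
    rwa [e] at h
  exact (hf.mul hm).integrable_of_hasCompactSupport hms.mul_left

/-- Reflection passes through mollification by an even kernel: `(f(−·) ⋆ moll_k)(x) = (f ⋆ moll_k)(−x)`. [folklore] -/
theorem weilConv_comp_neg_moll (f : ℝ → ℂ) (k : ℕ) (x : ℝ) :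
    weilConv (fun u : ℝ => f (-u)) (moll k) x = weilConv f (moll k) (-x) := by
  rw [weilConv_apply, weilConv_apply]
  have h := integral_neg_eq_self (fun u : ℝ => f u * moll k (-x - u)) volume
  rw [← h]
  refine integral_congr_ae (Eventually.of_forall fun u => ?_)
  simp only
  rw [show -x - -u = -(x - u) by ring, PfPersistence.moll_neg]

/-- **Odd part and mollification commute**: `((f − f(−·)) ⋆ moll_k)(x) = F(x) − F(−x)` with `F = f ⋆ moll_k`, `f` continuous.
[folklore] -/
theorem weilConv_oddPart_moll {f : ℝ → ℂ} (hf : Continuous f) (k : ℕ) (x : ℝ) :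
    weilConv (fun u : ℝ => f u - f (-u)) (moll k) x = weilConv f (moll k) x - weilConv f (moll k) (-x) := by
  have hi := integrable_mul_moll_comp_sub (f := fun u : ℝ => f (-u)) (hf.comp continuous_neg) k x
  rw [← weilConv_comp_neg_moll f k x, weilConv_apply, weilConv_apply, weilConv_apply,
    ← integral_sub (integrable_mul_moll_comp_sub hf k x) hi]
  refine integral_congr_ae (Eventually.of_forall fun u => ?_)
  ring

/-- A difference split also passes through mollification: `((f − g) ⋆ moll_k)(x) = (f ⋆ moll_k)(x) − (g ⋆ moll_k)(x)`
(`f, g` continuous). [folklore] -/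
theorem weilConv_sub_moll {f g : ℝ → ℂ} (hf : Continuous f) (hg : Continuous g) (k : ℕ) (x : ℝ) :
    weilConv (fun u : ℝ => f u - g u) (moll k) x = weilConv f (moll k) x - weilConv g (moll k) x := by
  rw [weilConv_apply, weilConv_apply, weilConv_apply,
    ← integral_sub (integrable_mul_moll_comp_sub hf k x) (integrable_mul_moll_comp_sub hg k x)]
  refine integral_congr_ae (Eventually.of_forall fun u => ?_)
  ring

/-- **Transform of an odd part**: `(F − F(−·))^(s) = F̂(s) − F̂(1 − s)` for `F` continuous with compact support. [folklore] -/
theorem weilMellin_oddPart {F : ℝ → ℂ} (hF : Continuous F) (hFs : HasCompactSupport F) (s : ℂ) :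
    weilMellin (fun x : ℝ => F x - F (-x)) s = weilMellin F s - weilMellin F (1 - s) := by
  have h := weilMellin_sub hF hFs (hF.comp continuous_neg) (hFs.comp_homeomorph (Homeomorph.neg ℝ)) s
  have e : (F - F ∘ fun a : ℝ => -a) = fun x : ℝ => F x - F (-x) := by funext x; simp
  rw [e] at h
  rw [h]
  exact congrArg _ (weilMellin_comp_neg F s)

/-- The mollified function `f ⋆ moll_k` of a continuous compactly supported `f` is continuous with compact support
(so `weilMellin_oddPart` applies to it). [folklore] -/
theorem continuous_hasCompactSupport_weilConv_moll {f : ℝ → ℂ} (hf : Continuous f) (hfs : HasCompactSupport f) (k : ℕ) :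
    Continuous (weilConv f (moll k)) ∧ HasCompactSupport (weilConv f (moll k)) :=
  ⟨(isWeilTest_weilConv_moll hf hfs k).1.continuous, (isWeilTest_weilConv_moll hf hfs k).2⟩

end Summit.RiemannHypothesis.RiemannHypothesis.Theorems.WeilColumn.ThetaMellin
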